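import Literature.Probability.RandomPlanarGeometry.KlebanZagierCrossing
import Literature.NumberTheory.EllipticCurves.JacobiThetaQuartic
import Mathlib.NumberTheory.ModularForms.Discriminant
import Mathlib.NumberTheory.ModularForms.LevelOne.DimensionFormula
import Mathlib.Analysis.Complex.LocallyUniformLimit
import Mathlib.Analysis.SpecificLimits.Normed
import HarnessLib

/-!
# Kleban–Zagier, Theorem 2 (corrected): a self-dual conformal block has dimension `0 < α ≤ 1/2`

P. Kleban, D. Zagier, *Crossing probabilities and modular forms*, J. Stat. Phys. **113** (2003),
431–454 (arXiv:math-ph/0209023), §5, Theorem 2, first conclusion — PROVED, with the hypothesis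
"`Π₁` non-constant" that the printed statement omits and its proof uses (the literal statement,
transcribed as `KlebanZagier.theorem2`, is false: `KlebanZagier.theorem2_false` in
`KlebanZagierCrossingProofs.lean`):

* **`KlebanZagier.theorem2_dim`**: if `Π₁` is a conformal block of dimension `α ∈ ℝ`
  (`KlebanZagier.IsConformalBlock Π₁ α a`: `Π₁(r) = ∑ aₙ e^{-πr(n+α)}`, `a₀ ≠ 0`) with coefficients
  of polynomial growth, `Π₁(1/r) = 1 - Π₁(r)` for `r > 0`, and `Π₁` is not constant, then
  `0 < α ≤ 1/2`.

The second conclusion of Theorem 2 (`Π₁(r) = Π_h(r;α)`, the generalized Cardy function) is not in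
this file.

## Proof

The printed proof (§5): continue `Π₁` to `P₁(τ) = ∑ aₙ e^{πiτ(n+α)}` on `ℍ`; `f₁ = P₁′` satisfies
`f₁|₂S = -f₁`, `f₁|₂T² = e^{2πiα} f₁`, is of polynomial growth, hence `f₁ ∈ M₂(Γ_θ, v)`; the valence
formula `ν_∞ + ν_1 + ½ν_i + Σ ν_P = 1/2` on `Γ_θ` then gives `0 < α ≤ 1/2`. We follow it up to the
valence formula, which Mathlib does not have, and replace that step by a **norm to level one**
(Mathlib has `S₁₂(SL₂(ℤ)) = ℂΔ`, `CuspForm.exists_smul_discriminant_of_weight_eq_twelve`, and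
`Δ ≠ 0`, `e^{-2π Im τ} = O(Δ)`):

1. `Disc`, `Qhat`, `Block`: `P(τ) = e^{πiατ} G(q̂)`, `f(τ) = P′(τ) = πi e^{πiατ} H(q̂)` with
   `q̂ = e^{πiτ}`, `G = ∑ aₙ wⁿ`, `H = ∑ aₙ(n+α) wⁿ` holomorphic on the unit disc (polynomially
   bounded coefficients); `P(ir) = Π₁(r)`; `f(τ+2) = e^{2πiα} f(τ)`.
2. `Duality`: `P(-1/τ) = 1 - P(τ)` on `ℍ` (identity theorem from the imaginary axis), hence
   `f(-1/τ) = -τ² f(τ)`.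
3. `Growth`: `|f(x+iy)| ≤ K y^{-(m+2)}` for `y ≤ 1`; `|f| ≤ M e^{-πα y}` for `y ≥ 1`
   (`≤ M e^{-π y}` if `α = 0`); `H(q̂(it)) → αa₀`.
4. `NegDim`: `α ≥ 0` (`|f(it)| = t⁻²|f(i/t)| ≤ K tᵐ` against `|f(it)| ≳ e^{π|α|t}`).
5. `Norm`, `LevelOne`: `N := f · f(·+1) · (f|₂TS)`, `(f|₂TS)(τ) = τ⁻² f((τ-1)/τ)`, satisfies
   `N(τ+1) = -N(τ)`, `N(-1/τ) = -τ⁶ N(τ)` (from the two laws of `f`; `TST = (S⁻¹T⁻²)·TS`), is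
   holomorphic, and `|N| ≤ M² e^{-2βy} K 2ᵏ yᵏ → 0`; so `N²` is a level-one cusp form of weight
   `12` (the tree's `JacobiThetaNull.cuspFormOf`), `N² = cΔ`, and `c ≠ 0` as `f ≢ 0` (isolated
   zeros). On the axis `|N(it)|² = |c||Δ(it)| ≳ e^{-2πt}` forces the decay rate `β` of `f` to
   satisfy `β ≤ π/2` (`decay_rate_le_half_pi`).
6. `Main`: non-constancy gives `f ≢ 0`; `α = 0` would give `β = π`, and `α > 0` gives
   `β = πα ≤ π/2`.

## References

* P. Kleban, D. Zagier, *Crossing probabilities and modular forms*, J. Stat. Phys. 113 (2003),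
  431–454, §5 Theorem 2 and its proof; §4 (valence formula (nogzs)). [KlebanZagier2003]
-/

noncomputable section

open Complex Real Filter Topology Asymptotics Set

open scoped Real

namespace Literature.Probability.RandomPlanarGeometry.KlebanZagier

/-! ### Power series with polynomially bounded coefficients on the unit disc -/

section Disc

/-- `(n+1)^m ≤ (n+m)(n+m-1)⋯(n+1)`. [folklore] -/
theorem pow_succ_le_descFactorial (n m : ℕ) : (n + 1) ^ m ≤ (n + m).descFactorial m := by
  induction m with
  | zero => simp
  | succ m ih =>
    calc (n + 1) ^ (m + 1) = (n + 1) * (n + 1) ^ m := pow_succ' _ _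
      _ ≤ (n + m + 1) * (n + m).descFactorial m := Nat.mul_le_mul (by omega) ih
      _ = (n + (m + 1)).descFactorial (m + 1) := by
        rw [show n + (m + 1) = n + m + 1 by omega, Nat.succ_descFactorial_succ]

/-- `(n+1)^m ≤ m! · C(n+m, m)` in `ℝ`. [folklore] -/
theorem pow_succ_le_factorial_mul_choose (n m : ℕ) :
    ((n : ℝ) + 1) ^ m ≤ (m.factorial : ℝ) * ((n + m).choose m : ℝ) := by
  have h := pow_succ_le_descFactorial n m
  rw [Nat.descFactorial_eq_factorial_mul_choose] at h
  exact_mod_cast h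

/-- The power series `∑ cₙ wⁿ` as a function on `ℂ` (junk outside the disc of convergence).
[folklore] -/
def discFun (c : ℕ → ℂ) (w : ℂ) : ℂ := ∑' n : ℕ, c n * w ^ n

/-- The summable majorant `C · m! · C(n+m,m) · ρⁿ` of a polynomially bounded power series on
`‖w‖ ≤ ρ`. [folklore] -/
def discMajorant (C : ℝ) (m : ℕ) (ρ : ℝ) (n : ℕ) : ℝ :=
  C * m.factorial * ((n + m).choose m : ℝ) * ρ ^ n

variable {c : ℕ → ℂ} {C : ℝ} {m : ℕ}

/-- The majorant sums to `C · m! / (1-ρ)^{m+1}`. [folklore] -/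
theorem hasSum_discMajorant (C : ℝ) (m : ℕ) {ρ : ℝ} (hρ0 : 0 ≤ ρ) (hρ : ρ < 1) :
    HasSum (discMajorant C m ρ) (C * m.factorial / (1 - ρ) ^ (m + 1)) := by
  have h := hasSum_choose_mul_geometric_of_norm_lt_one m (r := ρ)
    (by rwa [Real.norm_of_nonneg hρ0])
  have e : discMajorant C m ρ = fun n => C * m.factorial * (((n + m).choose m : ℝ) * ρ ^ n) := by
    funext n; simp only [discMajorant]; ring
  rw [e, show C * m.factorial / (1 - ρ) ^ (m + 1) = C * m.factorial * (1 / (1 - ρ) ^ (m + 1)) by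
    ring]
  exact h.mul_left _

/-- Termwise bound by the majorant. [folklore] -/
theorem norm_term_le_discMajorant (hc : ∀ n, ‖c n‖ ≤ C * ((n : ℝ) + 1) ^ m) (hC : 0 ≤ C)
    {ρ : ℝ} {w : ℂ} (hw : ‖w‖ ≤ ρ) (n : ℕ) :
    ‖c n * w ^ n‖ ≤ discMajorant C m ρ n := by
  rw [norm_mul, norm_pow, discMajorant]
  have h1 : ‖c n‖ ≤ C * m.factorial * ((n + m).choose m : ℝ) := by
    calc ‖c n‖ ≤ C * ((n : ℝ) + 1) ^ m := hc n
      _ ≤ C * ((m.factorial : ℝ) * ((n + m).choose m : ℝ)) :=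
        mul_le_mul_of_nonneg_left (pow_succ_le_factorial_mul_choose n m) hC
      _ = C * m.factorial * ((n + m).choose m : ℝ) := by ring
  have h2 : ‖w‖ ^ n ≤ ρ ^ n := pow_le_pow_left₀ (norm_nonneg _) hw n
  exact mul_le_mul h1 h2 (pow_nonneg (norm_nonneg _) n) (by positivity)

/-- `∑ cₙ wⁿ` converges (absolutely) on the open unit disc. [folklore] -/
theorem hasSum_discFun (hc : ∀ n, ‖c n‖ ≤ C * ((n : ℝ) + 1) ^ m) (hC : 0 ≤ C) {w : ℂ}
    (hw : ‖w‖ < 1) : HasSum (fun n : ℕ => c n * w ^ n) (discFun c w) := by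
  have hs : Summable fun n : ℕ => c n * w ^ n :=
    Summable.of_norm_bounded (hasSum_discMajorant C m (norm_nonneg w) hw).summable
      (norm_term_le_discMajorant hc hC le_rfl)
  exact hs.hasSum

/-- The bound `‖∑ cₙ wⁿ‖ ≤ C · m! / (1 - ‖w‖)^{m+1}` on the open unit disc. [folklore] -/
theorem norm_discFun_le (hc : ∀ n, ‖c n‖ ≤ C * ((n : ℝ) + 1) ^ m) (hC : 0 ≤ C) {w : ℂ}
    (hw : ‖w‖ < 1) : ‖discFun c w‖ ≤ C * m.factorial / (1 - ‖w‖) ^ (m + 1) := by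
  have hmaj := hasSum_discMajorant C m (norm_nonneg w) hw
  have hle := norm_term_le_discMajorant hc hC (le_refl ‖w‖)
  exact tsum_of_norm_bounded hmaj hle

/-- `∑ cₙ wⁿ` is holomorphic on the open unit disc. [folklore] -/
theorem differentiableOn_discFun (hc : ∀ n, ‖c n‖ ≤ C * ((n : ℝ) + 1) ^ m) (hC : 0 ≤ C) :
    DifferentiableOn ℂ (discFun c) (Metric.ball 0 1) := by
  intro w hw
  rw [Metric.mem_ball, dist_zero_right] at hw
  set ρ : ℝ := (‖w‖ + 1) / 2 with hρ
  have hρ0 : 0 ≤ ρ := by positivity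
  have hρ1 : ρ < 1 := by rw [hρ]; linarith
  have hwρ : ‖w‖ < ρ := by rw [hρ]; linarith
  have hdiff : DifferentiableOn ℂ (discFun c) (Metric.ball 0 ρ) := by
    refine differentiableOn_tsum_of_summable_norm (hasSum_discMajorant C m hρ0 hρ1).summable
      (fun n => ((differentiable_const (c n)).mul (differentiable_pow n)).differentiableOn)
      Metric.isOpen_ball (fun n z hz => ?_)
    rw [Metric.mem_ball, dist_zero_right] at hz
    exact norm_term_le_discMajorant hc hC hz.le n
  have hmem : w ∈ Metric.ball (0 : ℂ) ρ := by rwa [Metric.mem_ball, dist_zero_right]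
  exact (hdiff.differentiableAt (Metric.isOpen_ball.mem_nhds hmem)).differentiableWithinAt

/-- `∑ cₙ wⁿ` is complex differentiable at each point of the open unit disc. [folklore] -/
theorem differentiableAt_discFun (hc : ∀ n, ‖c n‖ ≤ C * ((n : ℝ) + 1) ^ m) (hC : 0 ≤ C)
    {w : ℂ} (hw : ‖w‖ < 1) : DifferentiableAt ℂ (discFun c) w :=
  (differentiableOn_discFun hc hC).differentiableAt
    (Metric.isOpen_ball.mem_nhds (by rwa [Metric.mem_ball, dist_zero_right]))

/-- Value at the centre: `(∑ cₙ wⁿ)(0) = c₀`. [folklore] -/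
theorem discFun_zero (c : ℕ → ℂ) : discFun c 0 = c 0 := by
  rw [discFun, tsum_eq_single 0]
  · simp
  · intro n hn
    simp [hn]

/-- Continuity at the centre: `∑ cₙ wⁿ → c₀` as `w → 0`. [folklore] -/
theorem tendsto_discFun_zero (hc : ∀ n, ‖c n‖ ≤ C * ((n : ℝ) + 1) ^ m) (hC : 0 ≤ C) :
    Tendsto (discFun c) (𝓝 0) (𝓝 (c 0)) := by
  have h := (differentiableAt_discFun hc hC (w := 0) (by simp)).continuousAt
  rwa [ContinuousAt, discFun_zero] at h

/-- Termwise derivative: `w · (∑ cₙ wⁿ)' = ∑ n cₙ wⁿ` on the open unit disc. [folklore] -/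
theorem mul_deriv_discFun (hc : ∀ n, ‖c n‖ ≤ C * ((n : ℝ) + 1) ^ m) (hC : 0 ≤ C) {w : ℂ}
    (hw : ‖w‖ < 1) :
    HasSum (fun n : ℕ => c n * (n : ℂ) * w ^ n) (w * deriv (discFun c) w) := by
  set ρ : ℝ := (‖w‖ + 1) / 2 with hρ
  have hρ0 : 0 ≤ ρ := by positivity
  have hρ1 : ρ < 1 := by rw [hρ]; linarith [norm_nonneg w]
  have hwρ : ‖w‖ < ρ := by rw [hρ]; linarith
  have hmem : w ∈ Metric.ball (0 : ℂ) ρ := by rwa [Metric.mem_ball, dist_zero_right]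
  have h := hasSum_deriv_of_summable_norm (F := fun n z => c n * z ^ n)
    (hasSum_discMajorant C m hρ0 hρ1).summable
    (fun n => ((differentiable_const (c n)).mul (differentiable_pow n)).differentiableOn)
    Metric.isOpen_ball (fun n z hz => by
      rw [Metric.mem_ball, dist_zero_right] at hz
      exact norm_term_le_discMajorant hc hC hz.le n) hmem
  have h' := h.mul_left w
  have hfun : (fun n : ℕ => c n * (n : ℂ) * w ^ n) =
      fun n : ℕ => w * deriv (fun z : ℂ => c n * z ^ n) w := by
    funext n
    have hd : deriv (fun z : ℂ => c n * z ^ n) w = c n * ((n : ℂ) * w ^ (n - 1)) := by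
      rw [deriv_const_mul _ (differentiableAt_pow n), deriv_pow_field]
    rw [hd]
    rcases Nat.eq_zero_or_pos n with rfl | hn
    · simp
    · rw [show w ^ n = w * w ^ (n - 1) by rw [← pow_succ', Nat.sub_add_cancel hn]]
      ring
  rw [hfun]
  exact h'

/-- Splitting off the constant term: `∑ cₙ wⁿ = c₀ + w ∑ c_{n+1} wⁿ`. [folklore] -/
theorem discFun_eq_zero_add (hc : ∀ n, ‖c n‖ ≤ C * ((n : ℝ) + 1) ^ m) (hC : 0 ≤ C) {w : ℂ}
    (hw : ‖w‖ < 1) : discFun c w = c 0 + w * discFun (fun n => c (n + 1)) w := by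
  have hs := (hasSum_discFun hc hC hw).summable
  rw [discFun, hs.tsum_eq_zero_add, discFun, ← tsum_mul_left]
  congr 1
  · simp
  · exact tsum_congr fun n => by ring

/-- Shifted coefficients are again polynomially bounded: `‖c_{n+1}‖ ≤ (2^m C) (n+1)^m`.
[folklore] -/
theorem norm_shift_le (hc : ∀ n, ‖c n‖ ≤ C * ((n : ℝ) + 1) ^ m) (hC : 0 ≤ C) (n : ℕ) :
    ‖c (n + 1)‖ ≤ 2 ^ m * C * ((n : ℝ) + 1) ^ m := by
  calc ‖c (n + 1)‖ ≤ C * (((n + 1 : ℕ) : ℝ) + 1) ^ m := hc (n + 1)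
    _ ≤ C * ((2 : ℝ) * ((n : ℝ) + 1)) ^ m := by
        apply mul_le_mul_of_nonneg_left _ hC
        apply pow_le_pow_left₀ (by positivity)
        push_cast; linarith [(n.cast_nonneg : (0 : ℝ) ≤ n)]
    _ = 2 ^ m * C * ((n : ℝ) + 1) ^ m := by rw [mul_pow]; ring

end Disc

/-! ### `q̂ = e^{πiτ}` -/

section Qhat

/-- `q̂(τ) = e^{πiτ}`, the local parameter at `i∞` for functions of period `2`. [folklore] -/
def qhat (τ : ℂ) : ℂ := cexp (π * I * τ)

/-- `|q̂(τ)| = e^{-π Im τ}`. [folklore] -/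
theorem norm_qhat (τ : ℂ) : ‖qhat τ‖ = rexp (-(π * im τ)) := by
  rw [qhat, Complex.norm_exp]
  congr 1
  simp

/-- `|q̂| < 1` on the upper half-plane. [folklore] -/
theorem norm_qhat_lt_one {τ : ℂ} (hτ : 0 < im τ) : ‖qhat τ‖ < 1 := by
  rw [norm_qhat, ← Real.exp_zero]
  exact Real.exp_lt_exp.mpr (by nlinarith [Real.pi_pos])

/-- `q̂(τ+2) = q̂(τ)`. [folklore] -/
theorem qhat_add_two (τ : ℂ) : qhat (τ + 2) = qhat τ := by
  rw [qhat, qhat, mul_add, Complex.exp_add, show (π * I * 2 : ℂ) = 2 * π * I by ring,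
    Complex.exp_two_pi_mul_I, mul_one]

/-- `q̂(τ+1) = -q̂(τ)`. [folklore] -/
theorem qhat_add_one (τ : ℂ) : qhat (τ + 1) = -qhat τ := by
  rw [qhat, qhat, mul_add, Complex.exp_add, mul_one, Complex.exp_pi_mul_I]
  ring

/-- `q̂' = πi q̂`. [folklore] -/
theorem hasDerivAt_qhat (τ : ℂ) : HasDerivAt qhat (π * I * qhat τ) τ := by
  unfold qhat
  have h : HasDerivAt (fun τ : ℂ => π * I * τ) (π * I * 1) τ := (hasDerivAt_id τ).const_mul (π * I)
  rw [mul_one] at h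
  exact h.cexp.congr_deriv (by ring)

/-- `q̂(it) = e^{-πt}` is real. [folklore] -/
theorem qhat_I_mul (t : ℝ) : qhat (I * t) = ((rexp (-(π * t)) : ℝ) : ℂ) := by
  rw [qhat, Complex.ofReal_exp]
  congr 1
  push_cast
  linear_combination (↑π * ↑t : ℂ) * I_sq

/-- `q̂ → 0` at `i∞`. [folklore] -/
theorem tendsto_qhat : Tendsto qhat (comap im atTop) (𝓝 0) := by
  rw [tendsto_zero_iff_norm_tendsto_zero]
  simp only [norm_qhat]
  refine Real.tendsto_exp_atBot.comp ?_
  have h1 : Tendsto (fun τ : ℂ => im τ) (comap im atTop) atTop := tendsto_comap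
  have h2 : Tendsto (fun τ : ℂ => π * im τ) (comap im atTop) atTop :=
    h1.const_mul_atTop Real.pi_pos
  exact tendsto_neg_atTop_atBot.comp h2

/-- `q̂(it) → 0` as `t → ∞`. [folklore] -/
theorem tendsto_qhat_I_mul : Tendsto (fun t : ℝ => qhat (I * t)) atTop (𝓝 0) := by
  refine tendsto_qhat.comp ?_
  refine tendsto_comap_iff.mpr ?_
  have : (im ∘ fun t : ℝ => (I * t : ℂ)) = id := by funext t; simp
  rw [this]
  exact tendsto_id

end Qhat

/-! ### The conformal block as a holomorphic function on `ℍ` -/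

section Block

variable (a : ℕ → ℝ) (α : ℝ)

/-- The coefficients `aₙ` as complex numbers. [folklore] -/
def coef (n : ℕ) : ℂ := (a n : ℂ)

/-- The coefficients `aₙ (n + α)` of `(πi)⁻¹ e^{-πiατ} P′(τ)`. [folklore] -/
def coefD (n : ℕ) : ℂ := (a n : ℂ) * ((n : ℂ) + α)

/-- `P(τ) = ∑ aₙ q̂^{n+α} = e^{πiατ} ∑ aₙ q̂ⁿ`, the conformal block continued to `ℍ`
(Kleban–Zagier, proof of Theorems 1–2: "define `P(τ)` by the same expression but with `q̂`
interpreted as `e^{πiτ}`"). [cite: KlebanZagier2003, §5 (proof of Theorem 1)] -/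
def blockExt (τ : ℂ) : ℂ := cexp (π * I * α * τ) * discFun (coef a) (qhat τ)

/-- `f(τ) = P′(τ) = πi e^{πiατ} ∑ aₙ (n+α) q̂ⁿ`. [cite: KlebanZagier2003, §5 (proof of Theorem 2)] -/
def blockDer (τ : ℂ) : ℂ := π * I * cexp (π * I * α * τ) * discFun (coefD a α) (qhat τ)

variable {a α} {C : ℝ} {m : ℕ}

/-- Polynomial growth with a real exponent implies polynomial growth with a natural exponent and a
non-negative constant. [folklore] -/
theorem polyGrowth_nat (h : ∃ C k : ℝ, ∀ n : ℕ, |a n| ≤ C * ((n : ℝ) + 1) ^ k) :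
    ∃ C : ℝ, ∃ m : ℕ, 0 ≤ C ∧ ∀ n : ℕ, |a n| ≤ C * ((n : ℝ) + 1) ^ m := by
  obtain ⟨C, k, h⟩ := h
  have hC : 0 ≤ C := by
    have := h 0
    simp only [Nat.cast_zero, zero_add, Real.one_rpow, mul_one] at this
    exact (abs_nonneg _).trans this
  refine ⟨C, ⌈max k 0⌉₊, hC, fun n => (h n).trans ?_⟩
  apply mul_le_mul_of_nonneg_left _ hC
  have h1 : (1 : ℝ) ≤ (n : ℝ) + 1 := by linarith [(n.cast_nonneg : (0 : ℝ) ≤ n)]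
  calc ((n : ℝ) + 1) ^ k ≤ ((n : ℝ) + 1) ^ ((⌈max k 0⌉₊ : ℕ) : ℝ) :=
        Real.rpow_le_rpow_of_exponent_le h1 ((le_max_left k 0).trans (Nat.le_ceil _))
    _ = ((n : ℝ) + 1) ^ ⌈max k 0⌉₊ := Real.rpow_natCast _ _

/-- `‖aₙ‖ ≤ C (n+1)^m`. [folklore] -/
theorem norm_coef_le (h : ∀ n : ℕ, |a n| ≤ C * ((n : ℝ) + 1) ^ m) (n : ℕ) :
    ‖coef a n‖ ≤ C * ((n : ℝ) + 1) ^ m := by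
  rw [coef, Complex.norm_real, Real.norm_eq_abs]
  exact h n

/-- `‖aₙ (n+α)‖ ≤ C (1+|α|) (n+1)^{m+1}`. [folklore] -/
theorem norm_coefD_le (h : ∀ n : ℕ, |a n| ≤ C * ((n : ℝ) + 1) ^ m) (hC : 0 ≤ C) (n : ℕ) :
    ‖coefD a α n‖ ≤ C * (1 + |α|) * ((n : ℝ) + 1) ^ (m + 1) := by
  rw [coefD, norm_mul, Complex.norm_real, Real.norm_eq_abs]
  have h1 : ‖(n : ℂ) + α‖ ≤ (1 + |α|) * ((n : ℝ) + 1) := by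
    calc ‖(n : ℂ) + α‖ ≤ ‖(n : ℂ)‖ + ‖(α : ℂ)‖ := norm_add_le _ _
      _ = n + |α| := by rw [Complex.norm_natCast, Complex.norm_real, Real.norm_eq_abs]
      _ ≤ (1 + |α|) * ((n : ℝ) + 1) := by
          nlinarith [abs_nonneg α, (n.cast_nonneg : (0 : ℝ) ≤ n)]
  calc |a n| * ‖(n : ℂ) + α‖ ≤ C * ((n : ℝ) + 1) ^ m * ((1 + |α|) * ((n : ℝ) + 1)) :=
        mul_le_mul (h n) h1 (norm_nonneg _) (by positivity)
    _ = C * (1 + |α|) * ((n : ℝ) + 1) ^ (m + 1) := by ring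

/-- **The continuation restricts to the block on the imaginary axis**: `P(ir) = Π(r)`.
[cite: KlebanZagier2003, §5 (proof of Theorem 1)] -/
theorem blockExt_I_mul {P : ℝ → ℝ} (hP : IsConformalBlock P α a) {r : ℝ} (hr : 0 < r) :
    blockExt a α (I * r) = P r := by
  have h := Complex.hasSum_ofReal.mpr (hP.2 r hr)
  have e : ∀ n : ℕ, (((a n * rexp (-(π * r * ((n : ℝ) + α))) : ℝ)) : ℂ) =
      cexp (π * I * α * (I * r)) * (coef a n * qhat (I * r) ^ n) := by
    intro n
    rw [Complex.ofReal_mul, Complex.ofReal_exp, qhat, ← Complex.exp_nat_mul, coef,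
      mul_left_comm, ← Complex.exp_add]
    congr 2
    push_cast
    linear_combination (-(↑π * ↑r * ((n : ℂ) + ↑α))) * I_sq
  simp_rw [e] at h
  set E : ℂ := cexp (π * I * α * (I * r)) with hE
  have hE0 : E ≠ 0 := Complex.exp_ne_zero _
  have h' := h.mul_left E⁻¹
  simp_rw [inv_mul_cancel_left₀ hE0] at h'
  rw [blockExt, discFun, h'.tsum_eq]
  show E * (E⁻¹ * (P r : ℂ)) = P r
  rw [mul_inv_cancel_left₀ hE0]

/-- `∑ aₙ(n+α) wⁿ = α ∑ aₙ wⁿ + w (∑ aₙ wⁿ)′`. [folklore] -/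
theorem discFun_coefD (h : ∀ n : ℕ, |a n| ≤ C * ((n : ℝ) + 1) ^ m) (hC : 0 ≤ C) {w : ℂ}
    (hw : ‖w‖ < 1) :
    discFun (coefD a α) w = α * discFun (coef a) w + w * deriv (discFun (coef a)) w := by
  have h1 := (hasSum_discFun (norm_coef_le h) hC hw).mul_left (α : ℂ)
  have h2 := mul_deriv_discFun (norm_coef_le h) hC hw
  have h3 := h1.add h2
  have h4 : HasSum (fun n => coefD a α n * w ^ n) (discFun (coefD a α) w) :=
    hasSum_discFun (norm_coefD_le h hC) (by positivity) hw
  refine h4.unique ?_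
  have e : (fun n => coefD a α n * w ^ n) =
      fun n => (α : ℂ) * (coef a n * w ^ n) + coef a n * (n : ℂ) * w ^ n := by
    funext n; simp only [coefD, coef]; ring
  rw [e]
  exact h3

/-- **`P′ = f`**: the continuation is holomorphic on `ℍ` with derivative `blockDer`.
[cite: KlebanZagier2003, §5 (proof of Theorem 2)] -/
theorem hasDerivAt_blockExt (h : ∀ n : ℕ, |a n| ≤ C * ((n : ℝ) + 1) ^ m) (hC : 0 ≤ C) {τ : ℂ}
    (hτ : 0 < im τ) : HasDerivAt (blockExt a α) (blockDer a α τ) τ := by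
  have hq : ‖qhat τ‖ < 1 := norm_qhat_lt_one hτ
  have hG : HasDerivAt (discFun (coef a)) (deriv (discFun (coef a)) (qhat τ)) (qhat τ) :=
    (differentiableAt_discFun (norm_coef_le h) hC hq).hasDerivAt
  have hGq := hG.comp τ (hasDerivAt_qhat τ)
  have hE : HasDerivAt (fun τ : ℂ => cexp (π * I * α * τ)) (cexp (π * I * α * τ) * (π * I * α)) τ := by
    have : HasDerivAt (fun τ : ℂ => π * I * α * τ) (π * I * α) τ := by
      simpa using (hasDerivAt_id τ).const_mul (π * I * α)
    exact this.cexp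
  have hprod := hE.mul hGq
  have e : blockDer a α τ = cexp (π * I * α * τ) * (π * I * α) * discFun (coef a) (qhat τ) +
      cexp (π * I * α * τ) * (deriv (discFun (coef a)) (qhat τ) * (π * I * qhat τ)) := by
    rw [blockDer, discFun_coefD h hC hq]; ring
  rw [e]
  exact hprod

/-- `P` is complex differentiable on `ℍ`. [folklore] -/
theorem differentiableAt_blockExt (h : ∀ n : ℕ, |a n| ≤ C * ((n : ℝ) + 1) ^ m) (hC : 0 ≤ C)
    {τ : ℂ} (hτ : 0 < im τ) : DifferentiableAt ℂ (blockExt a α) τ :=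
  (hasDerivAt_blockExt h hC hτ).differentiableAt

/-- `deriv P = f` on `ℍ`. [folklore] -/
theorem deriv_blockExt (h : ∀ n : ℕ, |a n| ≤ C * ((n : ℝ) + 1) ^ m) (hC : 0 ≤ C) {τ : ℂ}
    (hτ : 0 < im τ) : deriv (blockExt a α) τ = blockDer a α τ :=
  (hasDerivAt_blockExt h hC hτ).deriv

/-- `f` is complex differentiable on `ℍ`. [folklore] -/
theorem differentiableAt_blockDer (h : ∀ n : ℕ, |a n| ≤ C * ((n : ℝ) + 1) ^ m) (hC : 0 ≤ C)
    {τ : ℂ} (hτ : 0 < im τ) : DifferentiableAt ℂ (blockDer a α) τ := by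
  have hq : ‖qhat τ‖ < 1 := norm_qhat_lt_one hτ
  have hD : DifferentiableAt ℂ (discFun (coefD a α)) (qhat τ) :=
    differentiableAt_discFun (norm_coefD_le h hC) (by positivity) hq
  have hDq : DifferentiableAt ℂ (fun τ => discFun (coefD a α) (qhat τ)) τ :=
    hD.comp τ (hasDerivAt_qhat τ).differentiableAt
  have hE : DifferentiableAt ℂ (fun τ : ℂ => cexp (π * I * α * τ)) τ := by
    have : DifferentiableAt ℂ (fun τ : ℂ => π * I * α * τ) τ :=
      (differentiableAt_id.const_mul (π * I * α))
    exact this.cexp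
  exact ((differentiableAt_const _).mul hE).mul hDq

/-- `P(τ+2) = e^{2πiα} P(τ)`. [cite: KlebanZagier2003, §5 (proof of Theorem 2)] -/
theorem blockExt_add_two (τ : ℂ) :
    blockExt a α (τ + 2) = cexp (2 * π * I * α) * blockExt a α τ := by
  rw [blockExt, blockExt, qhat_add_two, show (π * I * α * (τ + 2) : ℂ) = π * I * α * τ + 2 * π * I * α by ring,
    Complex.exp_add]
  ring

/-- `f(τ+2) = e^{2πiα} f(τ)` ("`f₁|T² = A f₁`, with `A = e^{2πiα}`").
[cite: KlebanZagier2003, §5 (proof of Theorem 2)] -/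
theorem blockDer_add_two (τ : ℂ) :
    blockDer a α (τ + 2) = cexp (2 * π * I * α) * blockDer a α τ := by
  rw [blockDer, blockDer, qhat_add_two,
    show (π * I * α * (τ + 2) : ℂ) = π * I * α * τ + 2 * π * I * α by ring, Complex.exp_add]
  ring

/-- `|f(τ)| = π e^{-πα Im τ} |∑ aₙ(n+α) q̂ⁿ|`. [folklore] -/
theorem norm_blockDer (τ : ℂ) :
    ‖blockDer a α τ‖ = π * rexp (-(π * α * im τ)) * ‖discFun (coefD a α) (qhat τ)‖ := by
  rw [blockDer, norm_mul, norm_mul, norm_mul, Complex.norm_real, Complex.norm_I,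
    Real.norm_of_nonneg Real.pi_pos.le, Complex.norm_exp, mul_one]
  congr 2
  simp

end Block

/-! ### The duality on `ℍ`: `P(-1/τ) = 1 - P(τ)`, hence `f(-1/τ) = -τ² f(τ)` -/

section Duality

open Literature.NumberTheory.EllipticCurves.JacobiThetaNull (ne_zero_of_im_pos im_neg_one_div_pos
  neg_one_div_I_mul)

variable {a : ℕ → ℝ} {α : ℝ} {C : ℝ} {m : ℕ} {P : ℝ → ℝ}

/-- The open upper half-plane as a subset of `ℂ` is open. [folklore] -/
theorem isOpen_upperHalfPlaneSet' : IsOpen {z : ℂ | 0 < z.im} :=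
  isOpen_lt continuous_const Complex.continuous_im

/-- **Analytic continuation of the duality** (Kleban–Zagier, proof of Theorem 1: "By property (ii)
and analytic continuation, we have `P(-1/τ) = 1 - P(τ)`"): identity theorem on `ℍ` from the
positive imaginary axis. [cite: KlebanZagier2003, §5 (proof of Theorem 1)] -/
theorem blockExt_neg_one_div (hP : IsConformalBlock P α a)
    (h : ∀ n : ℕ, |a n| ≤ C * ((n : ℝ) + 1) ^ m) (hC : 0 ≤ C)
    (hdual : ∀ r : ℝ, 0 < r → P (1 / r) = 1 - P r) {τ : ℂ} (hτ : 0 < im τ) :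
    blockExt a α (-1 / τ) = 1 - blockExt a α τ := by
  set U : Set ℂ := {z : ℂ | 0 < z.im} with hU
  have hUo : IsOpen U := isOpen_upperHalfPlaneSet'
  have hUc : IsPreconnected U := (convex_halfSpace_im_gt 0).isPreconnected
  set F₁ : ℂ → ℂ := fun z => blockExt a α (-1 / z) with hF₁
  set F₂ : ℂ → ℂ := fun z => 1 - blockExt a α z with hF₂
  have hF₁d : DifferentiableOn ℂ F₁ U := by
    intro z hz
    have hz' : 0 < im (-1 / z) := im_neg_one_div_pos hz
    have h1 : DifferentiableAt ℂ (fun z : ℂ => -1 / z) z :=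
      (differentiableAt_const (-1 : ℂ)).div differentiableAt_id (ne_zero_of_im_pos hz)
    exact ((differentiableAt_blockExt h hC hz').comp z h1).differentiableWithinAt
  have hF₂d : DifferentiableOn ℂ F₂ U := fun z hz =>
    ((differentiableAt_const (1 : ℂ)).sub (differentiableAt_blockExt h hC hz)).differentiableWithinAt
  have hF₁a : AnalyticOnNhd ℂ F₁ U := hF₁d.analyticOnNhd hUo
  have hF₂a : AnalyticOnNhd ℂ F₂ U := hF₂d.analyticOnNhd hUo
  have hax : ∀ r : ℝ, 0 < r → F₁ (I * r) = F₂ (I * r) := by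
    intro r hr
    simp only [hF₁, hF₂]
    rw [neg_one_div_I_mul hr, blockExt_I_mul hP (inv_pos.mpr hr), blockExt_I_mul hP hr,
      ← one_div, hdual r hr]
    push_cast
    ring
  have hI : (I : ℂ) ∈ U := by show 0 < im I; simp
  have hcl : (I : ℂ) ∈ closure ({z | F₁ z = F₂ z} \ {I}) := by
    have ht : Tendsto (fun n : ℕ => (1 + 1 / ((n : ℝ) + 1) : ℝ)) atTop (𝓝 1) := by
      simpa using (tendsto_one_div_add_atTop_nhds_zero_nat).const_add (1 : ℝ)
    have ht' : Tendsto (fun n : ℕ => (I * ((1 + 1 / ((n : ℝ) + 1) : ℝ) : ℂ) : ℂ)) atTop (𝓝 I) := by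
      have := ((Complex.continuous_ofReal.tendsto 1).comp ht).const_mul I
      simpa using this
    refine mem_closure_of_tendsto ht' (Eventually.of_forall fun n => ⟨hax _ (by positivity), ?_⟩)
    intro heq
    have hx : (1 + 1 / ((n : ℝ) + 1) : ℝ) ≠ 1 := by
      have : (0 : ℝ) < 1 / ((n : ℝ) + 1) := by positivity
      linarith
    have heq' : I * ((1 + 1 / ((n : ℝ) + 1) : ℝ) : ℂ) = I * ((1 : ℝ) : ℂ) := by
      rw [Set.mem_singleton_iff.mp heq]; simp
    have := mul_left_cancel₀ I_ne_zero heq'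
    exact hx (by exact_mod_cast this)
  exact hF₁a.eqOn_of_preconnected_of_mem_closure hF₂a hUc hI hcl hτ

/-- **`f|₂S = -f`**: `f(-1/τ) = -τ² f(τ)` on `ℍ` (differentiate the continued duality).
[cite: KlebanZagier2003, §5 (proof of Theorem 2)] -/
theorem blockDer_neg_one_div (hP : IsConformalBlock P α a)
    (h : ∀ n : ℕ, |a n| ≤ C * ((n : ℝ) + 1) ^ m) (hC : 0 ≤ C)
    (hdual : ∀ r : ℝ, 0 < r → P (1 / r) = 1 - P r) {τ : ℂ} (hτ : 0 < im τ) :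
    blockDer a α (-1 / τ) = -τ ^ 2 * blockDer a α τ := by
  have hτ0 : τ ≠ 0 := ne_zero_of_im_pos hτ
  have hev : (fun z => blockExt a α (-1 / z)) =ᶠ[𝓝 τ] fun z => 1 - blockExt a α z := by
    filter_upwards [isOpen_upperHalfPlaneSet'.mem_nhds hτ] with z hz
      using blockExt_neg_one_div hP h hC hdual hz
  have hd := hev.deriv_eq
  have h1 : HasDerivAt (fun z : ℂ => -1 / z) (1 / τ ^ 2) τ := by
    have h0 := (hasDerivAt_inv hτ0).const_mul (-1 : ℂ)
    refine (h0.congr_of_eventuallyEq ?_).congr_deriv (by ring)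
    exact Eventually.of_forall fun z => by simp [div_eq_mul_inv]
  have hF₁ : HasDerivAt (fun z => blockExt a α (-1 / z)) (blockDer a α (-1 / τ) * (1 / τ ^ 2)) τ :=
    (hasDerivAt_blockExt h hC (im_neg_one_div_pos hτ)).comp τ h1
  have hF₂ : HasDerivAt (fun z => 1 - blockExt a α z) (0 - blockDer a α τ) τ :=
    (hasDerivAt_const τ (1 : ℂ)).sub (hasDerivAt_blockExt h hC hτ)
  rw [hF₁.deriv, hF₂.deriv] at hd
  calc blockDer a α (-1 / τ) = blockDer a α (-1 / τ) * (1 / τ ^ 2) * τ ^ 2 := by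
        rw [one_div, inv_mul_cancel_right₀ (pow_ne_zero 2 hτ0)]
    _ = (0 - blockDer a α τ) * τ ^ 2 := by rw [hd]
    _ = -τ ^ 2 * blockDer a α τ := by ring

end Duality

/-! ### Growth of `f`: polynomial near the real axis, exponential decay at `i∞` -/

section Growth

variable {a : ℕ → ℝ} {α : ℝ} {C : ℝ} {m : ℕ}

/-- `y/2 ≤ 1 - e^{-πy}` for `0 < y ≤ 1`. [folklore] -/
theorem half_le_one_sub_exp {y : ℝ} (hy0 : 0 < y) (hy1 : y ≤ 1) :
    y / 2 ≤ 1 - rexp (-(π * y)) := by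
  have hπ : (2 : ℝ) ≤ π := Real.two_le_pi
  have h1 : π * y + 1 ≤ rexp (π * y) := Real.add_one_le_exp _
  have hpos : 0 < π * y + 1 := by positivity
  have h2 : rexp (-(π * y)) ≤ (π * y + 1)⁻¹ := by
    rw [Real.exp_neg]
    exact inv_anti₀ hpos h1
  have h3 : y / 2 ≤ 1 - (π * y + 1)⁻¹ := by
    rw [← sub_nonneg]
    have e : 1 - (π * y + 1)⁻¹ - y / 2 = y * (2 * π - π * y - 1) / (2 * (π * y + 1)) := by
      field_simp
      ring
    rw [e]
    apply div_nonneg _ (by positivity)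
    apply mul_nonneg hy0.le
    nlinarith
  linarith

/-- **Polynomial growth near the real axis**: `|f(x+iy)| ≤ K y^{-(m+2)}` for `0 < y ≤ 1`, from
the polynomial growth of the `aₙ` ("`f₁` is … of polynomial growth because of the polynomial growth
assumption on the `aₙ`"). [cite: KlebanZagier2003, §5 (proof of Theorem 2)] -/
theorem norm_blockDer_le_of_im_le_one (h : ∀ n : ℕ, |a n| ≤ C * ((n : ℝ) + 1) ^ m) (hC : 0 ≤ C)
    {τ : ℂ} (hτ : 0 < im τ) (hτ1 : im τ ≤ 1) :
    ‖blockDer a α τ‖ ≤ π * rexp (π * |α|) * (C * (1 + |α|) * (m + 1).factorial * 2 ^ (m + 2)) /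
      (im τ) ^ (m + 2) := by
  set y := im τ with hy
  have hq : ‖qhat τ‖ < 1 := norm_qhat_lt_one hτ
  have hD := norm_discFun_le (norm_coefD_le (α := α) h hC) (by positivity) hq
  rw [norm_qhat] at hD
  have hgap : y / 2 ≤ 1 - rexp (-(π * y)) := half_le_one_sub_exp hτ hτ1
  have hgap0 : 0 < 1 - rexp (-(π * y)) := by linarith
  have hexp : rexp (-(π * α * y)) ≤ rexp (π * |α|) := by
    rw [Real.exp_le_exp]
    have h1 : -(π * α * y) ≤ |π * α * y| := neg_le_abs _
    rw [abs_mul, abs_mul, abs_of_pos Real.pi_pos, abs_of_pos hτ] at h1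
    nlinarith [mul_nonneg (mul_nonneg Real.pi_pos.le (abs_nonneg α)) (sub_nonneg.mpr hτ1)]
  have hfrac : 1 / (1 - rexp (-(π * y))) ^ (m + 2) ≤ 2 ^ (m + 2) / y ^ (m + 2) := by
    rw [div_le_div_iff₀ (pow_pos hgap0 _) (pow_pos hτ _), one_mul, ← mul_pow]
    apply pow_le_pow_left₀ hτ.le
    linarith
  rw [norm_blockDer]
  calc π * rexp (-(π * α * y)) * ‖discFun (coefD a α) (qhat τ)‖
      ≤ π * rexp (π * |α|) * (C * (1 + |α|) * (m + 1).factorial / (1 - rexp (-(π * y))) ^ (m + 1 + 1)) := by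
        apply mul_le_mul (mul_le_mul_of_nonneg_left hexp Real.pi_pos.le) hD (norm_nonneg _)
          (by positivity)
    _ = π * rexp (π * |α|) * (C * (1 + |α|) * (m + 1).factorial) *
          (1 / (1 - rexp (-(π * y))) ^ (m + 2)) := by ring
    _ ≤ π * rexp (π * |α|) * (C * (1 + |α|) * (m + 1).factorial) * (2 ^ (m + 2) / y ^ (m + 2)) := by
        apply mul_le_mul_of_nonneg_left hfrac (by positivity)
    _ = _ := by ring

/-- **Exponential decay at `i∞`**: `|f(τ)| ≤ M e^{-πα Im τ}` for `Im τ ≥ 1`. [folklore] -/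
theorem norm_blockDer_le_of_one_le_im (h : ∀ n : ℕ, |a n| ≤ C * ((n : ℝ) + 1) ^ m) (hC : 0 ≤ C)
    {τ : ℂ} (hτ1 : 1 ≤ im τ) :
    ‖blockDer a α τ‖ ≤ π * (C * (1 + |α|) * (m + 1).factorial / (1 - rexp (-π)) ^ (m + 2)) *
      rexp (-(π * α * im τ)) := by
  have hτ : 0 < im τ := by linarith
  have hq : ‖qhat τ‖ < 1 := norm_qhat_lt_one hτ
  have hD := norm_discFun_le (norm_coefD_le (α := α) h hC) (by positivity) hq
  have hqe : ‖qhat τ‖ ≤ rexp (-π) := by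
    rw [norm_qhat, Real.exp_le_exp]; nlinarith [Real.pi_pos]
  have hgap0 : 0 < 1 - rexp (-π) := by
    have : rexp (-π) < 1 := by rw [← Real.exp_zero]; exact Real.exp_lt_exp.mpr (by linarith [Real.pi_pos])
    linarith
  have hD' : ‖discFun (coefD a α) (qhat τ)‖ ≤
      C * (1 + |α|) * (m + 1).factorial / (1 - rexp (-π)) ^ (m + 2) := by
    refine hD.trans ?_
    apply div_le_div_of_nonneg_left (by positivity) (pow_pos hgap0 _)
    exact pow_le_pow_left₀ hgap0.le (by linarith) _
  rw [norm_blockDer]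
  calc π * rexp (-(π * α * im τ)) * ‖discFun (coefD a α) (qhat τ)‖
      ≤ π * rexp (-(π * α * im τ)) * (C * (1 + |α|) * (m + 1).factorial / (1 - rexp (-π)) ^ (m + 2)) :=
        mul_le_mul_of_nonneg_left hD' (by positivity)
    _ = _ := by ring

/-- **Dimension `0`: decay like `e^{-π Im τ}`** (the constant term of `∑ n aₙ q̂ⁿ` vanishes).
[folklore] -/
theorem norm_blockDer_zero_le_of_one_le_im (h : ∀ n : ℕ, |a n| ≤ C * ((n : ℝ) + 1) ^ m)
    (hC : 0 ≤ C) {τ : ℂ} (hτ1 : 1 ≤ im τ) :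
    ‖blockDer a 0 τ‖ ≤ π * (2 ^ (m + 1) * (C * (1 + |(0 : ℝ)|)) * (m + 1).factorial /
      (1 - rexp (-π)) ^ (m + 2)) * rexp (-(π * im τ)) := by
  have hτ : 0 < im τ := by linarith
  have hq : ‖qhat τ‖ < 1 := norm_qhat_lt_one hτ
  have hcD := norm_coefD_le (α := 0) h hC
  have hshift := norm_shift_le hcD (by positivity)
  have hsplit := discFun_eq_zero_add hcD (by positivity) hq
  have h0 : coefD a 0 0 = 0 := by simp [coefD]
  rw [h0, zero_add] at hsplit
  have hD := norm_discFun_le hshift (by positivity) hq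
  have hqe : ‖qhat τ‖ ≤ rexp (-π) := by
    rw [norm_qhat, Real.exp_le_exp]; nlinarith [Real.pi_pos]
  have hgap0 : 0 < 1 - rexp (-π) := by
    have : rexp (-π) < 1 := by rw [← Real.exp_zero]; exact Real.exp_lt_exp.mpr (by linarith [Real.pi_pos])
    linarith
  have hD' : ‖discFun (fun n => coefD a 0 (n + 1)) (qhat τ)‖ ≤
      2 ^ (m + 1) * (C * (1 + |(0 : ℝ)|)) * (m + 1).factorial / (1 - rexp (-π)) ^ (m + 2) := by
    refine hD.trans ?_
    apply div_le_div_of_nonneg_left (by positivity) (pow_pos hgap0 _)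
    exact pow_le_pow_left₀ hgap0.le (by linarith) _
  rw [norm_blockDer, hsplit, norm_mul, norm_qhat]
  simp only [mul_zero, zero_mul, neg_zero, Real.exp_zero, mul_one]
  calc π * (rexp (-(π * im τ)) * ‖discFun (fun n => coefD a 0 (n + 1)) (qhat τ)‖)
      ≤ π * (rexp (-(π * im τ)) *
        (2 ^ (m + 1) * (C * (1 + |(0 : ℝ)|)) * (m + 1).factorial / (1 - rexp (-π)) ^ (m + 2))) := by
        apply mul_le_mul_of_nonneg_left _ Real.pi_pos.le
        exact mul_le_mul_of_nonneg_left hD' (Real.exp_pos _).le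
    _ = _ := by ring

/-- The leading behaviour at `i∞` on the axis: `∑ aₙ(n+α) q̂(it)ⁿ → a₀ α`. [folklore] -/
theorem tendsto_discFun_coefD_axis (h : ∀ n : ℕ, |a n| ≤ C * ((n : ℝ) + 1) ^ m) (hC : 0 ≤ C) :
    Tendsto (fun t : ℝ => discFun (coefD a α) (qhat (I * t))) atTop (𝓝 ((a 0 : ℂ) * α)) := by
  have h1 := tendsto_discFun_zero (norm_coefD_le (α := α) h hC) (by positivity)
  have h2 := h1.comp tendsto_qhat_I_mul
  have e : coefD a α 0 = (a 0 : ℂ) * α := by simp [coefD]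
  rw [e] at h2
  exact h2

end Growth

/-! ### Negative dimension is impossible -/

section NegDim

open Literature.NumberTheory.EllipticCurves.JacobiThetaNull (neg_one_div_I_mul)

variable {a : ℕ → ℝ} {α : ℝ} {C : ℝ} {m : ℕ} {P : ℝ → ℝ}

/-- The `S`-law on the axis in norm: `|f(it)| = t⁻² |f(i/t)|`. [folklore] -/
theorem norm_blockDer_axis_S (hP : IsConformalBlock P α a)
    (h : ∀ n : ℕ, |a n| ≤ C * ((n : ℝ) + 1) ^ m) (hC : 0 ≤ C)
    (hdual : ∀ r : ℝ, 0 < r → P (1 / r) = 1 - P r) {t : ℝ} (ht : 0 < t) :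
    ‖blockDer a α (I * t)‖ = (t ^ 2)⁻¹ * ‖blockDer a α (I * (t⁻¹ : ℝ))‖ := by
  have him : 0 < im (I * (t⁻¹ : ℝ) : ℂ) := by simpa using inv_pos.mpr ht
  have hS := blockDer_neg_one_div hP h hC hdual him
  rw [neg_one_div_I_mul (inv_pos.mpr ht), inv_inv] at hS
  rw [hS, norm_mul, norm_neg, norm_pow, norm_mul, Complex.norm_I, one_mul, Complex.norm_real,
    Real.norm_eq_abs, abs_inv, abs_of_pos ht, inv_pow]

/-- **A conformal block of negative dimension with polynomially bounded coefficients cannot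
satisfy the duality (ii)**: `f|₂S = -f` and polynomial growth near `0` bound `|f(it)|`
polynomially as `t → ∞`, while `|f(it)| ~ π|αa₀| e^{π|α|t}` ("the assumption of polynomial
growth implies that `ν_∞(f)` … [is] non-negative"). [cite: KlebanZagier2003, §5 (proof of Theorem 2)] -/
theorem dim_nonneg (hP : IsConformalBlock P α a)
    (hgr : ∃ C k : ℝ, ∀ n : ℕ, |a n| ≤ C * ((n : ℝ) + 1) ^ k)
    (hdual : ∀ r : ℝ, 0 < r → P (1 / r) = 1 - P r) : 0 ≤ α := by
  by_contra hneg'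
  have hneg : α < 0 := lt_of_not_ge hneg'
  obtain ⟨C, m, hC, h⟩ := polyGrowth_nat hgr
  set K : ℝ := π * rexp (π * |α|) * (C * (1 + |α|) * (m + 1).factorial * 2 ^ (m + 2)) with hK
  have hK0 : 0 ≤ K := by positivity
  -- polynomial upper bound on the axis from the `S`-law
  have hup : ∀ t : ℝ, 1 ≤ t → ‖blockDer a α (I * t)‖ ≤ K * t ^ m := by
    intro t ht1
    have ht : 0 < t := by linarith
    rw [norm_blockDer_axis_S hP h hC hdual ht]
    have him : 0 < im (I * (t⁻¹ : ℝ) : ℂ) := by simpa using inv_pos.mpr ht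
    have him1 : im (I * (t⁻¹ : ℝ) : ℂ) ≤ 1 := by simpa using inv_le_one_of_one_le₀ ht1
    have hb := norm_blockDer_le_of_im_le_one (α := α) h hC him him1
    have hi : im (I * (t⁻¹ : ℝ) : ℂ) = t⁻¹ := by simp
    rw [hi] at hb
    have ht0 : t ≠ 0 := ht.ne'
    calc (t ^ 2)⁻¹ * ‖blockDer a α (I * (t⁻¹ : ℝ))‖ ≤ (t ^ 2)⁻¹ * (K / t⁻¹ ^ (m + 2)) :=
          mul_le_mul_of_nonneg_left hb (by positivity)
      _ = K * t ^ m := by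
          rw [inv_pow, div_inv_eq_mul, pow_add]
          calc (t ^ 2)⁻¹ * (K * (t ^ m * t ^ 2)) = K * t ^ m * ((t ^ 2)⁻¹ * t ^ 2) := by ring
            _ = K * t ^ m := by rw [inv_mul_cancel₀ (pow_ne_zero 2 ht0), mul_one]
  -- exponential lower bound on the axis, eventually
  have hlim := tendsto_discFun_coefD_axis (α := α) h hC
  have hne : (a 0 : ℂ) * α ≠ 0 :=
    mul_ne_zero (by exact_mod_cast hP.1) (by exact_mod_cast hneg.ne)
  have hpos : 0 < ‖(a 0 : ℂ) * α‖ := norm_pos_iff.mpr hne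
  have hev : ∀ᶠ t : ℝ in atTop, ‖(a 0 : ℂ) * α‖ / 2 ≤ ‖discFun (coefD a α) (qhat (I * t))‖ :=
    (hlim.norm).eventually (Ici_mem_nhds (half_lt_self hpos))
  have hev2 : ∀ᶠ t : ℝ in atTop,
      π * rexp (-(π * α * t)) * (‖(a 0 : ℂ) * α‖ / 2) ≤ K * t ^ m := by
    filter_upwards [hev, eventually_ge_atTop (1 : ℝ)] with t ht ht1
    calc π * rexp (-(π * α * t)) * (‖(a 0 : ℂ) * α‖ / 2)
        ≤ π * rexp (-(π * α * t)) * ‖discFun (coefD a α) (qhat (I * t))‖ :=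
          mul_le_mul_of_nonneg_left ht (by positivity)
      _ = ‖blockDer a α (I * t)‖ := by rw [norm_blockDer]; simp
      _ ≤ K * t ^ m := hup t ht1
  -- contradiction with the exponential growth of `e^{π|α|t}`
  have hgrow := tendsto_exp_mul_div_rpow_atTop (m : ℝ) (-(π * α)) (by nlinarith [Real.pi_pos])
  have hπc : 0 < π * ‖(a 0 : ℂ) * α‖ := by positivity
  have hbdd : ∀ᶠ t : ℝ in atTop,
      rexp (-(π * α) * t) / t ^ (m : ℝ) ≤ 2 * K / (π * ‖(a 0 : ℂ) * α‖) := by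
    filter_upwards [hev2, eventually_gt_atTop (0 : ℝ)] with t ht ht0
    rw [Real.rpow_natCast, div_le_iff₀ (pow_pos ht0 m), show -(π * α) * t = -(π * α * t) by ring,
      div_mul_eq_mul_div, le_div_iff₀ hπc]
    nlinarith [ht]
  have hcontra := hgrow.eventually (eventually_gt_atTop (2 * K / (π * ‖(a 0 : ℂ) * α‖)))
  obtain ⟨t, ht1, ht2⟩ := (hbdd.and hcontra).exists
  exact absurd ht2 (not_lt.mpr ht1)

end NegDim

/-! ### The norm down to level one: `N(f) = f · f|₂T · f|₂TS` -/

section Norm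

open Literature.NumberTheory.EllipticCurves.JacobiThetaNull (ne_zero_of_im_pos im_neg_one_div_pos)

/-- `(f|₂TS)(τ) = τ⁻² f((τ-1)/τ)` (slash by `TS = (1 -1; 1 0)`, weight `2`). [folklore] -/
def slashTS (f : ℂ → ℂ) (τ : ℂ) : ℂ := (τ ^ 2)⁻¹ * f ((τ - 1) / τ)

/-- The weight-`6` norm `N(f) = f · (f|₂T) · (f|₂TS)` over the three cosets of `Γ_θ` in `SL₂(ℤ)`
(representatives `1, T, TS`). Deviation from the printed proof, which applies the valence formula
on `Γ_θ` directly: Mathlib has the level-one theory, so we push the weight-`2` form on `Γ_θ` down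
to a weight-`12` level-one cusp form `N(f)²`. [folklore] -/
def normTS (f : ℂ → ℂ) (τ : ℂ) : ℂ := f τ * f (τ + 1) * slashTS f τ

variable {f : ℂ → ℂ} {A : ℂ}

/-- `Im((τ-1)/τ) = Im τ / |τ|²`. [folklore] -/
theorem im_sub_one_div_self {τ : ℂ} (hτ : τ ≠ 0) : im ((τ - 1) / τ) = im τ / Complex.normSq τ := by
  rw [show (τ - 1) / τ = 1 - τ⁻¹ by field_simp, sub_im, one_im, inv_im]
  ring

/-- `(τ-1)/τ ∈ ℍ` for `τ ∈ ℍ`. [folklore] -/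
theorem im_sub_one_div_self_pos {τ : ℂ} (hτ : 0 < im τ) : 0 < im ((τ - 1) / τ) := by
  rw [im_sub_one_div_self (ne_zero_of_im_pos hτ)]
  exact div_pos hτ (Complex.normSq_pos.mpr (ne_zero_of_im_pos hτ))

/-- **`N(f)(τ+1) = -N(f)(τ)`** from `f|₂T² = A f`, `f|₂S = -f` (`TST = (S⁻¹T⁻²)(TS)`).
[folklore] -/
theorem normTS_add_one (hA : A ≠ 0)
    (hT2 : ∀ τ : ℂ, 0 < im τ → f (τ + 2) = A * f τ)
    (hS : ∀ τ : ℂ, 0 < im τ → f (-1 / τ) = -τ ^ 2 * f τ) {τ : ℂ} (hτ : 0 < im τ) :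
    normTS f (τ + 1) = -normTS f τ := by
  have hτ0 : τ ≠ 0 := ne_zero_of_im_pos hτ
  have hτ1 : τ + 1 ≠ 0 := ne_zero_of_im_pos (by simpa using hτ)
  -- `σ = -(τ+1)/τ = -1 - 1/τ`, so that `τ/(τ+1) = -1/σ` and `σ + 2 = (τ-1)/τ`
  have hσeq : -(τ + 1) / τ = -1 - 1 / τ := by
    rw [neg_add', sub_div, neg_div, div_self hτ0]
  have hσim : 0 < im (-(τ + 1) / τ) := by
    have h1 := im_neg_one_div_pos hτ
    have h2 : im (-(τ + 1) / τ) = im (-1 / τ) := by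
      rw [hσeq, sub_im, neg_div, neg_im]
      simp
    rwa [h2]
  have e1 : (τ + 1 - 1) / (τ + 1) = -1 / (-(τ + 1) / τ) := by
    rw [add_sub_cancel_right, div_div_eq_mul_div, neg_one_mul, neg_div_neg_eq]
  have e2 : (τ - 1) / τ = -(τ + 1) / τ + 2 := by
    rw [div_add' _ _ _ hτ0]
    congr 1
    ring
  have e3 : f (-(τ + 1) / τ) = A⁻¹ * f ((τ - 1) / τ) := by
    rw [e2, hT2 _ hσim, inv_mul_cancel_left₀ hA]
  have e4 : (-(τ + 1) / τ) ^ 2 * ((τ + 1) ^ 2)⁻¹ = (τ ^ 2)⁻¹ := by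
    rw [div_pow, neg_sq, div_mul_eq_mul_div, mul_inv_cancel₀ (pow_ne_zero 2 hτ1), one_div]
  unfold normTS slashTS
  rw [e1, hS _ hσim, e3, show τ + 1 + 1 = τ + 2 by ring, hT2 τ hτ]
  calc f (τ + 1) * (A * f τ) * (((τ + 1) ^ 2)⁻¹ * (-(-(τ + 1) / τ) ^ 2 * (A⁻¹ * f ((τ - 1) / τ))))
      = -(f τ * f (τ + 1) * (((-(τ + 1) / τ) ^ 2 * ((τ + 1) ^ 2)⁻¹) * f ((τ - 1) / τ))) *
          (A * A⁻¹) := by ring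
    _ = -(f τ * f (τ + 1) * ((τ ^ 2)⁻¹ * f ((τ - 1) / τ))) := by
      rw [e4, mul_inv_cancel₀ hA, mul_one]

/-- **`N(f)(-1/τ) = -τ⁶ N(f)(τ)`** from `f|₂S = -f`. [folklore] -/
theorem normTS_neg_one_div
    (hS : ∀ τ : ℂ, 0 < im τ → f (-1 / τ) = -τ ^ 2 * f τ) {τ : ℂ} (hτ : 0 < im τ) :
    normTS f (-1 / τ) = -τ ^ 6 * normTS f τ := by
  have hτ0 : τ ≠ 0 := ne_zero_of_im_pos hτ
  have e1 : -1 / τ + 1 = (τ - 1) / τ := by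
    rw [div_add' _ _ _ hτ0]
    congr 1
    ring
  have e2 : (-1 / τ - 1) / (-1 / τ) = τ + 1 := by
    rw [div_eq_iff (div_ne_zero (by norm_num) hτ0), div_sub' hτ0, mul_div_assoc',
      div_eq_div_iff hτ0 hτ0]
    ring
  have e3 : ((-1 / τ) ^ 2)⁻¹ = τ ^ 2 := by
    rw [div_pow, neg_one_sq, one_div, inv_inv]
  unfold normTS slashTS
  rw [e1, e2, e3, hS τ hτ]
  have e5 : τ ^ 6 * (τ ^ 2)⁻¹ = τ ^ 4 := by
    rw [show τ ^ 6 = τ ^ 4 * τ ^ 2 by ring, mul_inv_cancel_right₀ (pow_ne_zero 2 hτ0)]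
  calc -τ ^ 2 * f τ * f ((τ - 1) / τ) * (τ ^ 2 * f (τ + 1))
      = -(τ ^ 4) * (f τ * f (τ + 1) * f ((τ - 1) / τ)) := by ring
    _ = -(τ ^ 6 * (τ ^ 2)⁻¹) * (f τ * f (τ + 1) * f ((τ - 1) / τ)) := by rw [e5]
    _ = -τ ^ 6 * (f τ * f (τ + 1) * ((τ ^ 2)⁻¹ * f ((τ - 1) / τ))) := by ring

/-- `N(f)` is complex differentiable on `ℍ` when `f` is. [folklore] -/
theorem differentiableAt_normTS (hhol : ∀ τ : ℂ, 0 < im τ → DifferentiableAt ℂ f τ) {τ : ℂ}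
    (hτ : 0 < im τ) : DifferentiableAt ℂ (normTS f) τ := by
  have hτ0 : τ ≠ 0 := ne_zero_of_im_pos hτ
  have h1 : DifferentiableAt ℂ f τ := hhol τ hτ
  have h2 : DifferentiableAt ℂ (fun z => f (z + 1)) τ :=
    (hhol (τ + 1) (by simpa using hτ)).comp τ (differentiableAt_id.add_const 1)
  have h3 : DifferentiableAt ℂ (fun z : ℂ => (z - 1) / z) τ :=
    (differentiableAt_id.sub_const 1).div differentiableAt_id hτ0
  have h4 : DifferentiableAt ℂ (f ∘ fun z : ℂ => (z - 1) / z) τ :=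
    DifferentiableAt.comp τ (by exact hhol _ (im_sub_one_div_self_pos hτ)) h3
  have h5 : DifferentiableAt ℂ (fun z : ℂ => (z ^ 2)⁻¹) τ :=
    (differentiableAt_pow 2).inv (pow_ne_zero 2 hτ0)
  exact (h1.mul h2).mul (h5.mul h4)

end Norm

/-! ### `N(f)²` is a weight-`12` level-one cusp form, hence a multiple of `Δ` -/

section LevelOne

open Literature.NumberTheory.EllipticCurves.JacobiThetaNull (cuspFormOf cuspFormOf_apply
  exists_eq_mul_discriminant ne_zero_of_im_pos im_neg_one_div_pos)

variable {f : ℂ → ℂ} {A : ℂ} {β M K : ℝ} {k : ℕ}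

/-- `‖N(f)(τ + n)‖ = ‖N(f)(τ)‖`. [folklore] -/
theorem norm_normTS_add_nat (hA : A ≠ 0)
    (hT2 : ∀ τ : ℂ, 0 < im τ → f (τ + 2) = A * f τ)
    (hS : ∀ τ : ℂ, 0 < im τ → f (-1 / τ) = -τ ^ 2 * f τ) {τ : ℂ} (hτ : 0 < im τ) (n : ℕ) :
    ‖normTS f (τ + n)‖ = ‖normTS f τ‖ := by
  induction n with
  | zero => simp
  | succ n ih =>
    have hτn : 0 < im (τ + n) := by simpa using hτ
    rw [show τ + ((n + 1 : ℕ) : ℂ) = τ + n + 1 by push_cast; ring, normTS_add_one hA hT2 hS hτn,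
      norm_neg, ih]

/-- `‖N(f)(τ + n)‖ = ‖N(f)(τ)‖` for integers `n`. [folklore] -/
theorem norm_normTS_add_int (hA : A ≠ 0)
    (hT2 : ∀ τ : ℂ, 0 < im τ → f (τ + 2) = A * f τ)
    (hS : ∀ τ : ℂ, 0 < im τ → f (-1 / τ) = -τ ^ 2 * f τ) {τ : ℂ} (hτ : 0 < im τ) (n : ℤ) :
    ‖normTS f (τ + n)‖ = ‖normTS f τ‖ := by
  obtain ⟨k, rfl | rfl⟩ := Int.eq_nat_or_neg n
  · exact_mod_cast norm_normTS_add_nat hA hT2 hS hτ k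
  · have hτk : 0 < im (τ + ((-(k : ℤ) : ℤ) : ℂ)) := by simpa using hτ
    have := norm_normTS_add_nat hA hT2 hS hτk k
    rw [show τ + ((-(k : ℤ) : ℤ) : ℂ) + (k : ℂ) = τ by push_cast; ring] at this
    exact this.symm

/-- The bound on `f|₂TS` high in a vertical strip: for `0 ≤ Re τ < 1 ≤ Im τ`,
`‖(f|₂TS)(τ)‖ ≤ K 2ᵏ (Im τ)ᵏ`. [folklore] -/
theorem norm_slashTS_le (hgr : ∀ τ : ℂ, 0 < im τ → im τ ≤ 1 → ‖f τ‖ ≤ K * (im τ)⁻¹ ^ k)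
    {τ : ℂ} (hre0 : 0 ≤ re τ) (hre1 : re τ < 1) (hτ : 1 ≤ im τ) :
    ‖slashTS f τ‖ ≤ K * 2 ^ k * (im τ) ^ k := by
  have hτ' : 0 < im τ := by linarith
  have hτ0 : τ ≠ 0 := ne_zero_of_im_pos hτ'
  have hK : 0 ≤ K := by
    have := hgr I (by simp) (by simp)
    simp only [I_im, inv_one, one_pow, mul_one] at this
    exact (norm_nonneg _).trans this
  have hns : Complex.normSq τ = re τ ^ 2 + im τ ^ 2 := by rw [Complex.normSq_apply]; ring
  have hns_lo : im τ ^ 2 ≤ Complex.normSq τ := by rw [hns]; nlinarith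
  have hns_hi : Complex.normSq τ ≤ 2 * im τ ^ 2 := by rw [hns]; nlinarith
  have hns_pos : 0 < Complex.normSq τ := Complex.normSq_pos.mpr hτ0
  have him : im ((τ - 1) / τ) = im τ / Complex.normSq τ := im_sub_one_div_self hτ0
  have him_pos : 0 < im ((τ - 1) / τ) := im_sub_one_div_self_pos hτ'
  have him_le : im ((τ - 1) / τ) ≤ 1 := by
    rw [him, div_le_one hns_pos]; nlinarith
  have hf := hgr _ him_pos him_le
  rw [him, inv_div] at hf
  have h1 : ‖(τ ^ 2)⁻¹‖ ≤ 1 := by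
    rw [norm_inv, norm_pow]
    apply inv_le_one_of_one_le₀
    have : 1 ≤ ‖τ‖ := by
      refine le_trans ?_ (Complex.abs_im_le_norm τ)
      rw [abs_of_pos hτ']
      exact hτ
    nlinarith
  have h2 : (Complex.normSq τ / im τ) ^ k ≤ 2 ^ k * (im τ) ^ k := by
    rw [← mul_pow]
    apply pow_le_pow_left₀ (by positivity)
    rw [div_le_iff₀ hτ']; nlinarith
  unfold slashTS
  rw [norm_mul]
  calc ‖(τ ^ 2)⁻¹‖ * ‖f ((τ - 1) / τ)‖ ≤ 1 * (K * (Complex.normSq τ / im τ) ^ k) :=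
        mul_le_mul h1 hf (norm_nonneg _) zero_le_one
    _ ≤ K * 2 ^ k * (im τ) ^ k := by
        rw [one_mul, mul_assoc]
        exact mul_le_mul_of_nonneg_left h2 hK

/-- **Decay of the norm at `i∞`**: `‖N(f)(τ)‖ ≤ (M e^{-β Im τ})² · K 2ᵏ (Im τ)ᵏ` for `Im τ ≥ 1`
(periodicity reduces to `0 ≤ Re τ < 1`). [folklore] -/
theorem norm_normTS_le (hA : A ≠ 0)
    (hT2 : ∀ τ : ℂ, 0 < im τ → f (τ + 2) = A * f τ)
    (hS : ∀ τ : ℂ, 0 < im τ → f (-1 / τ) = -τ ^ 2 * f τ)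
    (hdec : ∀ τ : ℂ, 1 ≤ im τ → ‖f τ‖ ≤ M * rexp (-(β * im τ)))
    (hgr : ∀ τ : ℂ, 0 < im τ → im τ ≤ 1 → ‖f τ‖ ≤ K * (im τ)⁻¹ ^ k)
    {τ : ℂ} (hτ : 1 ≤ im τ) :
    ‖normTS f τ‖ ≤ (M * rexp (-(β * im τ))) ^ 2 * (K * 2 ^ k * (im τ) ^ k) := by
  have hτ' : 0 < im τ := by linarith
  -- reduce to `0 ≤ re τ < 1`
  set τ₀ : ℂ := τ + ((-⌊re τ⌋ : ℤ) : ℂ) with hτ₀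
  have hτ₀im : im τ₀ = im τ := by simp [hτ₀]
  have hτ₀re : re τ₀ = Int.fract (re τ) := by
    show re τ₀ = re τ - ⌊re τ⌋
    rw [hτ₀, add_re, Complex.intCast_re, Int.cast_neg]
    ring
  have hre0 : 0 ≤ re τ₀ := by rw [hτ₀re]; exact Int.fract_nonneg _
  have hre1 : re τ₀ < 1 := by rw [hτ₀re]; exact Int.fract_lt_one _
  have hper : ‖normTS f τ‖ = ‖normTS f τ₀‖ := (norm_normTS_add_int hA hT2 hS hτ' _).symm
  rw [hper, ← hτ₀im]
  have h0 : 1 ≤ im τ₀ := by rwa [hτ₀im]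
  have hf0 : ‖f τ₀‖ ≤ M * rexp (-(β * im τ₀)) := hdec τ₀ h0
  have hf1 : ‖f (τ₀ + 1)‖ ≤ M * rexp (-(β * im τ₀)) := by
    have := hdec (τ₀ + 1) (by simpa using h0)
    simpa using this
  have hsl : ‖slashTS f τ₀‖ ≤ K * 2 ^ k * (im τ₀) ^ k := norm_slashTS_le hgr hre0 hre1 h0
  have hMe : 0 ≤ M * rexp (-(β * im τ₀)) := (norm_nonneg _).trans hf0
  unfold normTS
  rw [norm_mul, norm_mul]
  calc ‖f τ₀‖ * ‖f (τ₀ + 1)‖ * ‖slashTS f τ₀‖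
      ≤ (M * rexp (-(β * im τ₀))) * (M * rexp (-(β * im τ₀))) * (K * 2 ^ k * (im τ₀) ^ k) :=
        mul_le_mul (mul_le_mul hf0 hf1 (norm_nonneg _) hMe) hsl (norm_nonneg _)
          (mul_nonneg hMe hMe)
    _ = _ := by ring

/-- `N(f)²` extended by `0` off `ℍ`. [folklore] -/
def normSqExt (f : ℂ → ℂ) (τ : ℂ) : ℂ := if 0 < im τ then normTS f τ ^ 2 else 0

/-- **`N(f)² = c · Δ` on `ℍ`**: `N(f)²` is holomorphic on `ℍ`, invariant of weight `12` under `T`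
and `S`, and tends to `0` at `i∞`, hence a level-one cusp form of weight `12`, hence a multiple of
the discriminant (Mathlib's `CuspForm.exists_smul_discriminant_of_weight_eq_twelve`). This
replaces the valence formula on `Γ_θ` of the printed proof. [folklore] -/
theorem normTS_sq_eq_mul_discriminant (hA : A ≠ 0)
    (hhol : ∀ τ : ℂ, 0 < im τ → DifferentiableAt ℂ f τ)
    (hT2 : ∀ τ : ℂ, 0 < im τ → f (τ + 2) = A * f τ)
    (hS : ∀ τ : ℂ, 0 < im τ → f (-1 / τ) = -τ ^ 2 * f τ) (hβ : 0 < β)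
    (hdec : ∀ τ : ℂ, 1 ≤ im τ → ‖f τ‖ ≤ M * rexp (-(β * im τ)))
    (hgr : ∀ τ : ℂ, 0 < im τ → im τ ≤ 1 → ‖f τ‖ ≤ K * (im τ)⁻¹ ^ k) :
    ∃ c : ℂ, ∀ (τ : ℂ) (hτ : 0 < im τ),
      normTS f τ ^ 2 = c * ModularForm.discriminant ⟨τ, hτ⟩ := by
  have hT : ∀ τ : ℂ, normSqExt f (τ + 1) = normSqExt f τ := by
    intro τ
    by_cases hτ : 0 < im τ
    · have hτ1 : 0 < im (τ + 1) := by simpa using hτ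
      simp only [normSqExt, if_pos hτ, if_pos hτ1, normTS_add_one hA hT2 hS hτ, neg_sq]
    · have hτ1 : ¬ 0 < im (τ + 1) := by simpa using hτ
      simp only [normSqExt, if_neg hτ, if_neg hτ1]
  have hS' : ∀ τ : ℂ, 0 < im τ → normSqExt f (-1 / τ) = τ ^ 12 * normSqExt f τ := by
    intro τ hτ
    simp only [normSqExt, if_pos hτ, if_pos (im_neg_one_div_pos hτ), normTS_neg_one_div hS hτ]
    ring
  have hhol' : ∀ τ : ℂ, 0 < im τ → DifferentiableAt ℂ (normSqExt f) τ := by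
    intro τ hτ
    have hev : normSqExt f =ᶠ[𝓝 τ] fun z => normTS f z ^ 2 := by
      filter_upwards [isOpen_upperHalfPlaneSet'.mem_nhds hτ] with z hz
      simp only [normSqExt, if_pos (show 0 < im z from hz)]
    exact hev.differentiableAt_iff.mpr ((differentiableAt_normTS hhol hτ).pow 2)
  have hzero : Tendsto (normSqExt f) (comap im atTop) (𝓝 0) := by
    set G : ℝ → ℝ := fun y => ((M * rexp (-(β * y))) ^ 2 * (K * 2 ^ k * y ^ k)) ^ 2 with hG
    have hGt : Tendsto G atTop (𝓝 0) := by
      have h1 := tendsto_rpow_mul_exp_neg_mul_atTop_nhds_zero (k : ℝ) (2 * β) (by positivity)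
      have h2 : Tendsto (fun y : ℝ => (M ^ 2 * (K * 2 ^ k)) * (y ^ (k : ℝ) * rexp (-(2 * β) * y)))
          atTop (𝓝 ((M ^ 2 * (K * 2 ^ k)) * 0)) := h1.const_mul _
      rw [mul_zero] at h2
      have h3 := h2.pow 2
      rw [zero_pow two_ne_zero] at h3
      refine h3.congr fun y => ?_
      simp only [hG, Real.rpow_natCast]
      have : rexp (-(β * y)) ^ 2 = rexp (-(2 * β) * y) := by
        rw [← Real.exp_nat_mul]; congr 1; push_cast; ring
      rw [← this]; ring
    refine squeeze_zero_norm' ?_ (hGt.comp tendsto_comap)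
    have hmem : {τ : ℂ | 1 ≤ im τ} ∈ comap im atTop := ⟨Set.Ici 1, Ici_mem_atTop 1, fun τ h => h⟩
    filter_upwards [hmem] with τ hτ
    have hτ' : 0 < im τ := by linarith [show (1 : ℝ) ≤ im τ from hτ]
    simp only [normSqExt, if_pos hτ', Function.comp, hG, norm_pow]
    exact pow_le_pow_left₀ (norm_nonneg _) (norm_normTS_le hA hT2 hS hdec hgr hτ) 2
  obtain ⟨c, hc⟩ := exists_eq_mul_discriminant (cuspFormOf (normSqExt f) hT hS' hhol' hzero)
  refine ⟨c, fun τ hτ => ?_⟩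
  have := hc ⟨τ, hτ⟩
  rw [cuspFormOf_apply] at this
  simpa [normSqExt, if_pos hτ] using this

/-- If `f ≢ 0` on `ℍ` then `N(f) ≢ 0` on `ℍ` (zeros of holomorphic functions are isolated).
[folklore] -/
theorem exists_normTS_ne_zero (hhol : ∀ τ : ℂ, 0 < im τ → DifferentiableAt ℂ f τ)
    (hf : ∃ τ : ℂ, 0 < im τ ∧ f τ ≠ 0) : ∃ τ : ℂ, 0 < im τ ∧ normTS f τ ≠ 0 := by
  set U : Set ℂ := {z : ℂ | 0 < z.im} with hU
  have hUo : IsOpen U := isOpen_upperHalfPlaneSet'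
  have hUc : IsPreconnected U := (convex_halfSpace_im_gt 0).isPreconnected
  obtain ⟨z₁, hz₁, hfz₁⟩ := hf
  -- generic: a holomorphic function on `U` not identically zero is eventually non-zero near `z₁`
  have key : ∀ F : ℂ → ℂ, DifferentiableOn ℂ F U → (∃ z ∈ U, F z ≠ 0) →
      ∀ᶠ z in 𝓝[≠] z₁, F z ≠ 0 := by
    intro F hF hex
    have hFa : AnalyticOnNhd ℂ F U := hF.analyticOnNhd hUo
    rcases (hFa z₁ hz₁).eventually_eq_zero_or_eventually_ne_zero with h0 | h0
    · exfalso
      obtain ⟨z, hz, hFz⟩ := hex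
      exact hFz (hFa.eqOn_zero_of_preconnected_of_eventuallyEq_zero hUc hz₁ h0 hz)
    · exact h0
  have h1 : ∀ᶠ z in 𝓝[≠] z₁, f z ≠ 0 :=
    key f (fun z hz => (hhol z hz).differentiableWithinAt) ⟨z₁, hz₁, hfz₁⟩
  have h2 : ∀ᶠ z in 𝓝[≠] z₁, f (z + 1) ≠ 0 := by
    refine key (fun z => f (z + 1)) (fun z hz => ?_) ⟨z₁ - 1, by simpa [hU] using hz₁, by simpa using hfz₁⟩
    exact ((hhol (z + 1) (by simpa [hU] using hz)).comp z
      (differentiableAt_id.add_const 1)).differentiableWithinAt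
  have h3 : ∀ᶠ z in 𝓝[≠] z₁, f ((z - 1) / z) ≠ 0 := by
    have hne1 : (1 : ℂ) - z₁ ≠ 0 := by
      intro h
      have := congrArg im h
      simp at this
      exact (ne_of_gt hz₁) this
    refine key (fun z => f ((z - 1) / z)) (fun z hz => ?_) ⟨(1 - z₁)⁻¹, ?_, ?_⟩
    · have hz' : 0 < im z := hz
      have h3 : DifferentiableAt ℂ (fun z : ℂ => (z - 1) / z) z :=
        (differentiableAt_id.sub_const 1).div differentiableAt_id (ne_zero_of_im_pos hz')
      have h4 : DifferentiableAt ℂ (f ∘ fun z : ℂ => (z - 1) / z) z :=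
        DifferentiableAt.comp z (by exact hhol _ (im_sub_one_div_self_pos hz')) h3
      exact h4.differentiableWithinAt
    · show 0 < im ((1 - z₁)⁻¹)
      rw [inv_im, div_pos_iff]
      left
      refine ⟨by simpa using hz₁, Complex.normSq_pos.mpr hne1⟩
    · have e : ((1 - z₁)⁻¹ - 1) / (1 - z₁)⁻¹ = z₁ := by
        field_simp
        ring
      rw [e]
      exact hfz₁
  have h4 : ∀ᶠ z in 𝓝[≠] z₁, z ∈ U := mem_nhdsWithin_of_mem_nhds (hUo.mem_nhds hz₁)
  obtain ⟨z, hz1, hz2, hz3, hz4⟩ := (h1.and (h2.and (h3.and h4))).exists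
  refine ⟨z, hz4, ?_⟩
  unfold normTS slashTS
  exact mul_ne_zero (mul_ne_zero hz1 hz2)
    (mul_ne_zero (inv_ne_zero (pow_ne_zero 2 (ne_zero_of_im_pos hz4))) hz3)

/-- **The decay rate at `i∞` is at most `e^{-(π/2) Im τ}`**: if `f ≢ 0` satisfies `f|₂T² = Af`,
`f|₂S = -f`, `|f| ≤ M e^{-β Im τ}` high up and polynomial growth near the real axis, then
`β ≤ π/2`. (`N(f)² = cΔ` with `c ≠ 0` forces `|N(f)(it)| ≍ e^{-πt}`, while
`|N(f)(it)| ≤ M² e^{-2βt} · K 2ᵏ tᵏ`.) This is the level-one form of the valence count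
`ν_∞ + ν_1 + … = 1/2` of the printed proof. [cite: KlebanZagier2003, §5 (proof of Theorem 2)] -/
theorem decay_rate_le_half_pi (hA : A ≠ 0)
    (hhol : ∀ τ : ℂ, 0 < im τ → DifferentiableAt ℂ f τ)
    (hT2 : ∀ τ : ℂ, 0 < im τ → f (τ + 2) = A * f τ)
    (hS : ∀ τ : ℂ, 0 < im τ → f (-1 / τ) = -τ ^ 2 * f τ) (hβ : 0 < β)
    (hdec : ∀ τ : ℂ, 1 ≤ im τ → ‖f τ‖ ≤ M * rexp (-(β * im τ)))
    (hgr : ∀ τ : ℂ, 0 < im τ → im τ ≤ 1 → ‖f τ‖ ≤ K * (im τ)⁻¹ ^ k)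
    (hf : ∃ τ : ℂ, 0 < im τ ∧ f τ ≠ 0) : β ≤ π / 2 := by
  obtain ⟨c, hc⟩ := normTS_sq_eq_mul_discriminant hA hhol hT2 hS hβ hdec hgr
  obtain ⟨τ₁, hτ₁, hN₁⟩ := exists_normTS_ne_zero hhol hf
  have hc0 : c ≠ 0 := by
    intro h0
    apply hN₁
    have := hc τ₁ hτ₁
    rw [h0, zero_mul] at this
    exact pow_eq_zero_iff two_ne_zero |>.mp this
  -- lower bound for `Δ` high up: `e^{-2π Im z} ≤ C'' ‖Δ z‖` for `Im z ≥ A₀`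
  obtain ⟨C', hC'⟩ := ModularForm.exp_isBigO_discriminant.bound
  obtain ⟨A₀, hA₀⟩ := (UpperHalfPlane.atImInfty_mem _).mp hC'
  set C'' : ℝ := max C' 0 with hC''
  have hC''0 : 0 ≤ C'' := le_max_right _ _
  by_contra hcon
  have hβ' : π / 2 < β := lt_of_not_ge hcon
  -- along the axis `τ = it`, `t ≥ max A₀ 1`
  have hbound : ∀ t : ℝ, max A₀ 1 ≤ t →
      rexp (-(2 * π * t)) ≤ C'' / ‖c‖ * ((M * rexp (-(β * t))) ^ 2 * (K * 2 ^ k * t ^ k)) ^ 2 := by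
    intro t ht
    have ht1 : 1 ≤ t := le_trans (le_max_right _ _) ht
    have ht0 : 0 < t := by linarith
    have him : 0 < im (I * t : ℂ) := by simpa using ht0
    have him' : im (I * t : ℂ) = t := by simp
    have himz : UpperHalfPlane.im ⟨I * t, him⟩ = t := by
      show (I * (t : ℂ)).im = t
      exact him'
    have hz := hA₀ ⟨I * t, him⟩ (by rw [himz]; exact le_trans (le_max_left _ _) ht)
    simp only [Set.mem_setOf_eq] at hz
    rw [himz, Real.norm_of_nonneg (Real.exp_pos _).le] at hz
    have hN := norm_normTS_le hA hT2 hS hdec hgr (τ := I * t) (by rw [him']; exact ht1)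
    rw [him'] at hN
    have hΔ : ‖ModularForm.discriminant ⟨I * t, him⟩‖ = ‖normTS f (I * t)‖ ^ 2 / ‖c‖ := by
      have e := hc (I * t) him
      rw [eq_div_iff (norm_ne_zero_iff.mpr hc0), mul_comm, ← norm_pow, ← norm_mul, ← e]
    rw [hΔ] at hz
    calc rexp (-(2 * π * t)) = rexp (-2 * π * t) := by ring_nf
      _ ≤ C' * (‖normTS f (I * t)‖ ^ 2 / ‖c‖) := hz
      _ ≤ C'' * (‖normTS f (I * t)‖ ^ 2 / ‖c‖) :=
          mul_le_mul_of_nonneg_right (le_max_left _ _) (by positivity)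
      _ = C'' / ‖c‖ * ‖normTS f (I * t)‖ ^ 2 := by ring
      _ ≤ C'' / ‖c‖ * ((M * rexp (-(β * t))) ^ 2 * (K * 2 ^ k * t ^ k)) ^ 2 := by
          apply mul_le_mul_of_nonneg_left _ (div_nonneg hC''0 (norm_nonneg c))
          exact pow_le_pow_left₀ (norm_nonneg _) hN 2
  -- exponential versus polynomial growth
  set D : ℝ := C'' / ‖c‖ * (M ^ 2) ^ 2 * (K * 2 ^ k) ^ 2 with hD
  have hgrow := tendsto_exp_mul_div_rpow_atTop ((2 * k : ℕ) : ℝ) (4 * β - 2 * π) (by linarith)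
  have hev := hgrow.eventually (eventually_gt_atTop D)
  have hev2 : ∀ᶠ t : ℝ in atTop, rexp ((4 * β - 2 * π) * t) / t ^ ((2 * k : ℕ) : ℝ) ≤ D := by
    filter_upwards [eventually_ge_atTop (max A₀ 1)] with t ht
    have ht0 : 0 < t := by linarith [le_max_right A₀ 1]
    have hb := hbound t ht
    rw [Real.rpow_natCast, div_le_iff₀ (pow_pos ht0 _)]
    have e1 : rexp ((4 * β - 2 * π) * t) = rexp (-(2 * π * t)) * rexp (4 * β * t) := by
      rw [← Real.exp_add]; ring_nf
    have e0 : rexp (-(β * t)) ^ 4 * rexp (4 * β * t) = 1 := by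
      have : ((4 : ℕ) : ℝ) * -(β * t) + 4 * β * t = 0 := by push_cast; ring
      rw [← Real.exp_nat_mul, ← Real.exp_add, this, Real.exp_zero]
    have e2 : C'' / ‖c‖ * ((M * rexp (-(β * t))) ^ 2 * (K * 2 ^ k * t ^ k)) ^ 2 * rexp (4 * β * t) =
        D * t ^ (2 * k) := by
      rw [hD]
      calc C'' / ‖c‖ * ((M * rexp (-(β * t))) ^ 2 * (K * 2 ^ k * t ^ k)) ^ 2 * rexp (4 * β * t)
          = C'' / ‖c‖ * (M ^ 2) ^ 2 * (K * 2 ^ k) ^ 2 * t ^ (2 * k) *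
              (rexp (-(β * t)) ^ 4 * rexp (4 * β * t)) := by ring
        _ = _ := by rw [e0, mul_one]
    rw [e1]
    calc rexp (-(2 * π * t)) * rexp (4 * β * t)
        ≤ C'' / ‖c‖ * ((M * rexp (-(β * t))) ^ 2 * (K * 2 ^ k * t ^ k)) ^ 2 * rexp (4 * β * t) :=
          mul_le_mul_of_nonneg_right hb (Real.exp_pos _).le
      _ = D * t ^ (2 * k) := e2
  obtain ⟨t, h1, h2⟩ := (hev2.and hev).exists
  exact absurd h1 (not_le.mpr h2)

end LevelOne

/-! ### Kleban–Zagier Theorem 2, corrected: the dimension bounds -/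

section Main

variable {a : ℕ → ℝ} {α : ℝ} {P : ℝ → ℝ}

/-- A non-constant conformal block has `f = P′ ≢ 0` on `ℍ`. [folklore] -/
theorem exists_blockDer_ne_zero (hP : IsConformalBlock P α a)
    {C : ℝ} {m : ℕ} (h : ∀ n : ℕ, |a n| ≤ C * ((n : ℝ) + 1) ^ m) (hC : 0 ≤ C)
    (hnc : ∃ r s : ℝ, 0 < r ∧ 0 < s ∧ P r ≠ P s) :
    ∃ τ : ℂ, 0 < im τ ∧ blockDer a α τ ≠ 0 := by
  by_contra hall
  simp only [not_exists, not_and, not_not] at hall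
  obtain ⟨r, s, hr, hs, hne⟩ := hnc
  apply hne
  have hdiff : DifferentiableOn ℂ (blockExt a α) {z : ℂ | 0 < z.im} :=
    fun z hz => (differentiableAt_blockExt h hC hz).differentiableWithinAt
  have hder : Set.EqOn (deriv (blockExt a α)) 0 {z : ℂ | 0 < z.im} := by
    intro z hz
    rw [deriv_blockExt h hC hz, hall z hz]
    rfl
  have key := isOpen_upperHalfPlaneSet'.is_const_of_deriv_eq_zero
    (convex_halfSpace_im_gt 0).isPreconnected hdiff hder
    (x := I * r) (y := I * s) (by simpa using hr) (by simpa using hs)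
  rw [blockExt_I_mul hP hr, blockExt_I_mul hP hs] at key
  exact_mod_cast key

/-- **Kleban–Zagier, Theorem 2 (corrected), first conclusion: `0 < α ≤ 1/2`.** If `Π₁` is a
non-constant conformal block of dimension `α ∈ ℝ` with coefficients of polynomial growth and
`Π₁(1/r) = 1 - Π₁(r)`, then `0 < α ≤ 1/2`. ("Eq. (nogzs) therefore implies that `0 < α ≤ 1/2`";
here via the level-one norm `N(P₁′)² ∈ S₁₂(SL₂(ℤ)) = ℂΔ` instead of the valence formula on
`Γ_θ`. The non-constancy hypothesis is exactly what the printed statement omits: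
`theorem2_false`.) [cite: KlebanZagier2003, §5 Theorem 2] -/
theorem theorem2_dim (P : ℝ → ℝ) (α : ℝ) (a : ℕ → ℝ) (hP : IsConformalBlock P α a)
    (hgr : ∃ C k : ℝ, ∀ n : ℕ, |a n| ≤ C * ((n : ℝ) + 1) ^ k)
    (hdual : ∀ r : ℝ, 0 < r → P (1 / r) = 1 - P r)
    (hnc : ∃ r s : ℝ, 0 < r ∧ 0 < s ∧ P r ≠ P s) :
    0 < α ∧ α ≤ 1 / 2 := by
  obtain ⟨C, m, hC, h⟩ := polyGrowth_nat hgr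
  have hα0 : 0 ≤ α := dim_nonneg hP hgr hdual
  have hf : ∃ τ : ℂ, 0 < im τ ∧ blockDer a α τ ≠ 0 := exists_blockDer_ne_zero hP h hC hnc
  have hA : cexp (2 * π * I * α) ≠ 0 := Complex.exp_ne_zero _
  have hhol : ∀ τ : ℂ, 0 < im τ → DifferentiableAt ℂ (blockDer a α) τ :=
    fun τ hτ => differentiableAt_blockDer h hC hτ
  have hT2 : ∀ τ : ℂ, 0 < im τ → blockDer a α (τ + 2) = cexp (2 * π * I * α) * blockDer a α τ :=
    fun τ _ => blockDer_add_two τ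
  have hS : ∀ τ : ℂ, 0 < im τ → blockDer a α (-1 / τ) = -τ ^ 2 * blockDer a α τ :=
    fun τ hτ => blockDer_neg_one_div hP h hC hdual hτ
  set K : ℝ := π * rexp (π * |α|) * (C * (1 + |α|) * (m + 1).factorial * 2 ^ (m + 2)) with hK
  have hgr' : ∀ τ : ℂ, 0 < im τ → im τ ≤ 1 → ‖blockDer a α τ‖ ≤ K * (im τ)⁻¹ ^ (m + 2) := by
    intro τ hτ hτ1
    have := norm_blockDer_le_of_im_le_one (α := α) h hC hτ hτ1
    rwa [inv_pow, ← div_eq_mul_inv]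
  rcases hα0.eq_or_lt with hzero | hpos
  · -- `α = 0`: `f` decays like `e^{-π Im τ}`, contradicting `β ≤ π/2`
    exfalso
    subst hzero
    set M₀ : ℝ := π * (2 ^ (m + 1) * (C * (1 + |(0 : ℝ)|)) * (m + 1).factorial /
      (1 - rexp (-π)) ^ (m + 2)) with hM₀
    have hdec : ∀ τ : ℂ, 1 ≤ im τ → ‖blockDer a 0 τ‖ ≤ M₀ * rexp (-(π * im τ)) :=
      fun τ hτ => norm_blockDer_zero_le_of_one_le_im h hC hτ
    have := decay_rate_le_half_pi hA hhol hT2 hS Real.pi_pos hdec hgr' hf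
    linarith [Real.pi_pos]
  · refine ⟨hpos, ?_⟩
    set M : ℝ := π * (C * (1 + |α|) * (m + 1).factorial / (1 - rexp (-π)) ^ (m + 2)) with hM
    have hdec : ∀ τ : ℂ, 1 ≤ im τ → ‖blockDer a α τ‖ ≤ M * rexp (-(π * α * im τ)) :=
      fun τ hτ => norm_blockDer_le_of_one_le_im h hC hτ
    have := decay_rate_le_half_pi (β := π * α) hA hhol hT2 hS (by positivity) hdec hgr' hf
    nlinarith [Real.pi_pos]

end Main

end Literature.Probability.RandomPlanarGeometry.KlebanZagier

end
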